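import Literature.Topology.FourManifolds.KirbyMovesSlideEndInverse
import Literature.Topology.FourManifolds.KirbyMovesSlideEndFlatModel
import Literature.Topology.FourManifolds.DehnSurgeryTwistProofs
import Literature.Topology.FourManifolds.BandFrames
import HarnessLib

/-!
# The flat sheet through the push-off

Topic `Literature/Topology/FourManifolds`; fact seat `provefact-IsStrictHandleSlide.isSurgery`
(R. C. Kirby, *The Topology of 4-Manifolds*, LNM 1374 (1989), Ch. I §4; remaining content: the
named fact (S) `Literature.Topology.FourManifolds.FramedLink.IsStrictHandleSlide.slideModel`).
After the end normalisation (`KirbyMovesSlideEndNorm.exists_endNorm`) the slide band is, near its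
right edge, the product-flat model `(x₀, x₁) ↦ ν (θ₁ x₁, (1 + (1 - x₀) e x₁) • e₀)` (`θ₁ = thetaB`,
`e = edgeRate > 0`). The same formula for **all** `x₀` parametrises the half-plane sheet of the
tube of `Kⱼ` in the collar direction `e₀`: for `x₀ > 1` it runs from the push-off (`x₀ = 1`) into
the collar towards `Kⱼ`. This **flat sheet** carries the finger move of the attaching circle
through the push-off (`SheetFamily.lean`). This file defines it and proves: agreement with the flat
model, smoothness (read in `ℝ⁴`) on the height window, injectivity where `e ≠ 0`, and injectivity
of its differential (the tube coordinate map is an immersion, `tubeFrameDet_coordMap_pos`).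

* `BandCore.flatSheet` (definition), `flatSheet_eq_thickeningFlat`, `coe_flatSheet`,
  `Knot.TubularNbhd.injective_fderiv_coordMap`, `contDiffOn_coe_flatSheet`,
  `injOn_flatSheet`, `injective_fderiv_coe_flatSheet`.

## References

* R. C. Kirby, *The Topology of 4-Manifolds*, LNM 1374, Springer (1989), Ch. I §4. [Kirby1989]
* A. A. Kosinski, *Differential Manifolds* (1993), Ch. III §2. [Kosinski1993]
-/

open scoped Manifold ContDiff Topology Real
open Function Set Metric

noncomputable section

namespace Literature.Topology.FourManifolds

/-- **The tube coordinate map is an immersion**: `D coordMap (θ, w)` is injective (its three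
partial derivatives complete the position vector to a positively oriented frame of `ℝ⁴`,
`tubeFrameDet_coordMap_pos`). [folklore] -/
theorem Knot.TubularNbhd.injective_fderiv_coordMap {K : Knot} (ν : Knot.TubularNbhd K) (θ : ℝ) (w : EuclideanSpace ℝ (Fin 2)) :
    Injective (fderiv ℝ ν.coordMap (θ, w)) := by
  have hdet := (ν.tubeFrameDet_coordMap_pos θ w).ne'
  rw [tubeFrameDet_def] at hdet
  set L := fderiv ℝ ν.coordMap (θ, w) with hL
  -- it suffices that the kernel is trivial
  suffices hker : ∀ q : ℝ × EuclideanSpace ℝ (Fin 2), L q = 0 → q = 0 by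
    intro q q' hqq
    have : L (q - q') = 0 := by rw [map_sub, hqq, sub_self]
    exact sub_eq_zero.1 (hker _ this)
  intro q hq
  have hq' : q = q.1 • ((1 : ℝ), (0 : EuclideanSpace ℝ (Fin 2))) + (q.2 0) • ((0 : ℝ), EuclideanSpace.single (0 : Fin 2) (1 : ℝ)) +
      (q.2 1) • ((0 : ℝ), EuclideanSpace.single (1 : Fin 2) (1 : ℝ)) := by
    ext
    · simp
    · rename_i i
      fin_cases i <;> simp
  have h0 : (0 : ℝ) • ν.coordMap (θ, w) + q.1 • L (1, 0) + q.2 0 • L (0, EuclideanSpace.single 0 1) +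
      q.2 1 • L (0, EuclideanSpace.single 1 1) = 0 := by
    have := hq
    rw [hq'] at this
    simp only [map_add, map_smul] at this
    rw [zero_smul, zero_add]
    exact this
  obtain ⟨-, h1, h2, h3⟩ := eq_zero_of_frameDet_ne_zero_four hdet h0
  rw [hq', h1, h2, h3]
  simp

/-- The base vector in coordinates: `e₀ 0 = 1/2`. [folklore] -/
theorem framingBaseVector_apply_zero' : framingBaseVector 0 = 1 / 2 := by
  simp [framingBaseVector, circlePoint_apply_zero]

namespace BandCore

variable [Knot.TubularNbhd.SmoothnessFacts] {A Kj : Knot} (ν : Knot.TubularNbhd Kj)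
  {avoid : Set (Metric.sphere (0 : EuclideanSpace ℝ (Fin 4)) 1)} (b : BandCore A ν.pushOff avoid)

/-- **The flat sheet**: `(x₀, x₁) ↦ ν (θ₁ x₁, (1 + (1 - x₀) e x₁) • e₀)` for all `x₀`.
[cite: Kirby1989, Ch. I §4] -/
def flatSheet (x : EuclideanSpace ℝ (Fin 2)) : Metric.sphere (0 : EuclideanSpace ℝ (Fin 4)) 1 :=
  ν (circlePt (b.thetaB (x 1)), (1 + (1 - x 0) * b.edgeRate ν (x 1)) • framingBaseVector)

/-- Unfolding lemma. [folklore] -/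
theorem flatSheet_apply (x : EuclideanSpace ℝ (Fin 2)) :
    b.flatSheet ν x = ν (circlePt (b.thetaB (x 1)), (1 + (1 - x 0) * b.edgeRate ν (x 1)) • framingBaseVector) := rfl

/-- The flat sheet is the zero level of the flat thickening model. [folklore] -/
theorem flatSheet_eq_thickeningFlat (x : EuclideanSpace ℝ (Fin 2)) : b.flatSheet ν x = b.thickeningFlat ν (x, 0) := by
  rw [flatSheet, thickeningFlat_apply, zero_smul, add_zero]

/-- On the right edge the flat sheet is the push-off. [folklore] -/
theorem flatSheet_pt2_one (y : ℝ) : b.flatSheet ν (pt2 1 y) = ν.pushOff (circlePt (b.thetaB y)) := by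
  rw [flatSheet_eq_thickeningFlat, thickeningFlat_pt2_one_zero]

/-- The flat sheet in the tube coordinates: `coordMap (2π θ₁ x₁, (1 + (1 - x₀) e x₁) • e₀)`.
[folklore] -/
theorem coe_flatSheet (x : EuclideanSpace ℝ (Fin 2)) :
    ((b.flatSheet ν x : Metric.sphere (0 : EuclideanSpace ℝ (Fin 4)) 1) : EuclideanSpace ℝ (Fin 4)) =
      ν.coordMap (2 * π * b.thetaB (x 1), (1 + (1 - x 0) * b.edgeRate ν (x 1)) • framingBaseVector) := by
  rw [flatSheet, Knot.TubularNbhd.coordMap_apply, circlePt_eq_circlePoint]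

/-- The coordinate part of the flat sheet, `x ↦ (2π θ₁ x₁, (1 + (1 - x₀) e x₁) • e₀)`, is `C^∞`
on the height window. [folklore] -/
theorem contDiffOn_flatSheetCoord :
    ContDiffOn ℝ ∞ (fun x : EuclideanSpace ℝ (Fin 2) ↦
      ((2 * π * b.thetaB (x 1), (1 + (1 - x 0) * b.edgeRate ν (x 1)) • framingBaseVector) : ℝ × EuclideanSpace ℝ (Fin 2)))
      {x | x 1 ∈ Ioo (10⁻¹ : ℝ) (9 / 10)} := by
  have hx1 : ContDiff ℝ ∞ (fun x : EuclideanSpace ℝ (Fin 2) ↦ x 1) := contDiff_euclidean.1 contDiff_id 1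
  have hx0 : ContDiff ℝ ∞ (fun x : EuclideanSpace ℝ (Fin 2) ↦ x 0) := contDiff_euclidean.1 contDiff_id 0
  have hθ : ContDiffOn ℝ ∞ (fun x : EuclideanSpace ℝ (Fin 2) ↦ b.thetaB (x 1)) {x | x 1 ∈ Ioo (10⁻¹ : ℝ) (9 / 10)} :=
    fun x hx ↦ ((b.contDiffAt_thetaB hx).comp x hx1.contDiffAt).contDiffWithinAt
  have he : ContDiffOn ℝ ∞ (fun x : EuclideanSpace ℝ (Fin 2) ↦ b.edgeRate ν (x 1)) {x | x 1 ∈ Ioo (10⁻¹ : ℝ) (9 / 10)} :=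
    (b.contDiffOn_edgeRate ν).comp hx1.contDiffOn fun x hx ↦ hx
  exact (contDiffOn_const.mul hθ).prodMk
    ((contDiffOn_const.add ((contDiffOn_const.sub hx0.contDiffOn).mul he)).smul contDiffOn_const)

/-- **The flat sheet is `C^∞` on the height window** (read in `ℝ⁴`). [folklore] -/
theorem contDiffOn_coe_flatSheet :
    ContDiffOn ℝ ∞ (fun x ↦ ((b.flatSheet ν x : Metric.sphere (0 : EuclideanSpace ℝ (Fin 4)) 1) : EuclideanSpace ℝ (Fin 4)))
      {x | x 1 ∈ Ioo (10⁻¹ : ℝ) (9 / 10)} := by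
  have h := ν.contDiff_coordMap.comp_contDiffOn (b.contDiffOn_flatSheetCoord ν)
  refine h.congr fun x _ ↦ ?_
  exact b.coe_flatSheet ν x

/-- **The flat sheet is injective** on heights in `[1/10, 9/10]` where `e ≠ 0`. [folklore] -/
theorem injOn_flatSheet :
    InjOn (b.flatSheet ν) {x | x 1 ∈ Icc (10⁻¹ : ℝ) (9 / 10) ∧ b.edgeRate ν (x 1) ≠ 0} := by
  intro x hx x' hx' he
  rw [flatSheet, flatSheet] at he
  have h := ν.injective he
  have h1 : circlePt (b.thetaB (x 1)) = circlePt (b.thetaB (x' 1)) := congrArg Prod.fst h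
  have h2 : (1 + (1 - x 0) * b.edgeRate ν (x 1)) • framingBaseVector =
      (1 + (1 - x' 0) * b.edgeRate ν (x' 1)) • framingBaseVector := congrArg Prod.snd h
  have hy : x 1 = x' 1 := b.eq_of_circlePt_thetaB_eq ν hx.1 hx'.1 h1
  have hr : 1 + (1 - x 0) * b.edgeRate ν (x 1) = 1 + (1 - x' 0) * b.edgeRate ν (x' 1) := by
    have := congrArg (fun w : EuclideanSpace ℝ (Fin 2) ↦ w 0) h2
    change (1 + (1 - x 0) * b.edgeRate ν (x 1)) * framingBaseVector 0 =
      (1 + (1 - x' 0) * b.edgeRate ν (x' 1)) * framingBaseVector 0 at this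
    rw [framingBaseVector_apply_zero'] at this
    linarith
  rw [← hy] at hr
  have hx0 : x 0 = x' 0 := by
    have : (x 0 - x' 0) * b.edgeRate ν (x 1) = 0 := by linarith
    rcases mul_eq_zero.1 this with h | h
    · linarith
    · exact absurd h hx.2
  ext i; fin_cases i
  · exact hx0
  · exact hy

/-- The derivative of the coordinate part of the flat sheet. [folklore] -/
theorem hasFDerivAt_flatSheetCoord {x : EuclideanSpace ℝ (Fin 2)} (hx : x 1 ∈ Ioo (10⁻¹ : ℝ) (9 / 10)) :
    HasFDerivAt (fun x : EuclideanSpace ℝ (Fin 2) ↦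
      ((2 * π * b.thetaB (x 1), (1 + (1 - x 0) * b.edgeRate ν (x 1)) • framingBaseVector) : ℝ × EuclideanSpace ℝ (Fin 2)))
      (((2 * π * deriv b.thetaB (x 1)) • (EuclideanSpace.proj (1 : Fin 2) : EuclideanSpace ℝ (Fin 2) →L[ℝ] ℝ)).prod
        (((-b.edgeRate ν (x 1)) • (EuclideanSpace.proj (0 : Fin 2) : EuclideanSpace ℝ (Fin 2) →L[ℝ] ℝ) +
          ((1 - x 0) * deriv (b.edgeRate ν) (x 1)) • (EuclideanSpace.proj (1 : Fin 2) : EuclideanSpace ℝ (Fin 2) →L[ℝ] ℝ)).smulRight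
            framingBaseVector)) x := by
  have hp0 : HasFDerivAt (fun x : EuclideanSpace ℝ (Fin 2) ↦ x 0)
      (EuclideanSpace.proj (0 : Fin 2) : EuclideanSpace ℝ (Fin 2) →L[ℝ] ℝ) x :=
    (EuclideanSpace.proj (0 : Fin 2) : EuclideanSpace ℝ (Fin 2) →L[ℝ] ℝ).hasFDerivAt
  have hp1 : HasFDerivAt (fun x : EuclideanSpace ℝ (Fin 2) ↦ x 1)
      (EuclideanSpace.proj (1 : Fin 2) : EuclideanSpace ℝ (Fin 2) →L[ℝ] ℝ) x :=
    (EuclideanSpace.proj (1 : Fin 2) : EuclideanSpace ℝ (Fin 2) →L[ℝ] ℝ).hasFDerivAt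
  have hθ : HasFDerivAt (fun x : EuclideanSpace ℝ (Fin 2) ↦ b.thetaB (x 1))
      ((deriv b.thetaB (x 1)) • (EuclideanSpace.proj (1 : Fin 2) : EuclideanSpace ℝ (Fin 2) →L[ℝ] ℝ)) x := by
    have hd : HasDerivAt b.thetaB (deriv b.thetaB (x 1)) (x 1) :=
      ((b.contDiffAt_thetaB hx).differentiableAt (by simp)).hasDerivAt
    refine (hd.hasFDerivAt.comp x hp1).congr_fderiv (ContinuousLinearMap.ext fun v ↦ ?_)
    simp [mul_comm]
  have he : HasFDerivAt (fun x : EuclideanSpace ℝ (Fin 2) ↦ b.edgeRate ν (x 1))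
      ((deriv (b.edgeRate ν) (x 1)) • (EuclideanSpace.proj (1 : Fin 2) : EuclideanSpace ℝ (Fin 2) →L[ℝ] ℝ)) x := by
    have hd : HasDerivAt (b.edgeRate ν) (deriv (b.edgeRate ν) (x 1)) (x 1) :=
      (((b.contDiffOn_edgeRate ν).contDiffAt (Ioo_mem_nhds hx.1 hx.2)).differentiableAt (by simp)).hasDerivAt
    refine (hd.hasFDerivAt.comp x hp1).congr_fderiv (ContinuousLinearMap.ext fun v ↦ ?_)
    simp [mul_comm]
  have hr : HasFDerivAt (fun x : EuclideanSpace ℝ (Fin 2) ↦ 1 + (1 - x 0) * b.edgeRate ν (x 1))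
      ((-b.edgeRate ν (x 1)) • (EuclideanSpace.proj (0 : Fin 2) : EuclideanSpace ℝ (Fin 2) →L[ℝ] ℝ) +
        ((1 - x 0) * deriv (b.edgeRate ν) (x 1)) • (EuclideanSpace.proj (1 : Fin 2) : EuclideanSpace ℝ (Fin 2) →L[ℝ] ℝ)) x := by
    refine ((((hasFDerivAt_const (1 : ℝ) x).sub hp0).mul he).const_add 1).congr_fderiv (ContinuousLinearMap.ext fun v ↦ ?_)
    simp
    ring
  have hθ2 : HasFDerivAt (fun x : EuclideanSpace ℝ (Fin 2) ↦ 2 * π * b.thetaB (x 1))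
      ((2 * π * deriv b.thetaB (x 1)) • (EuclideanSpace.proj (1 : Fin 2) : EuclideanSpace ℝ (Fin 2) →L[ℝ] ℝ)) x := by
    refine (hθ.const_mul (2 * π)).congr_fderiv (ContinuousLinearMap.ext fun v ↦ ?_)
    simp [mul_assoc]
  exact hθ2.prodMk (hr.smul_const framingBaseVector)

omit [Knot.TubularNbhd.SmoothnessFacts] in
/-- The coordinate derivative is injective when `θ₁' ≠ 0` and `e ≠ 0`. [folklore] -/
theorem injective_flatSheetCoordDeriv {x0 d e e' : ℝ} (hd : d ≠ 0) (he : e ≠ 0) :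
    Injective ((((2 * π * d) • (EuclideanSpace.proj (1 : Fin 2) : EuclideanSpace ℝ (Fin 2) →L[ℝ] ℝ)).prod
        (((-e) • (EuclideanSpace.proj (0 : Fin 2) : EuclideanSpace ℝ (Fin 2) →L[ℝ] ℝ) +
          ((1 - x0) * e') • (EuclideanSpace.proj (1 : Fin 2) : EuclideanSpace ℝ (Fin 2) →L[ℝ] ℝ)).smulRight
            framingBaseVector)) : EuclideanSpace ℝ (Fin 2) →L[ℝ] ℝ × EuclideanSpace ℝ (Fin 2)) := by
  intro v v' hvv
  have h1 := congrArg Prod.fst hvv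
  have h2 := congrArg (fun p : ℝ × EuclideanSpace ℝ (Fin 2) ↦ p.2 0) hvv
  change 2 * π * d * v 1 = 2 * π * d * v' 1 at h1
  change ((-e) * v 0 + (1 - x0) * e' * v 1) * framingBaseVector 0 =
    ((-e) * v' 0 + (1 - x0) * e' * v' 1) * framingBaseVector 0 at h2
  rw [framingBaseVector_apply_zero'] at h2
  have hv1 : v 1 = v' 1 := by
    have : 2 * π * d * (v 1 - v' 1) = 0 := by linarith
    rcases mul_eq_zero.1 this with h | h
    · exact absurd h (by positivity)
    · linarith
  have hv0 : v 0 = v' 0 := by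
    rw [hv1] at h2
    have : e * (v 0 - v' 0) = 0 := by linarith
    rcases mul_eq_zero.1 this with h | h
    · exact absurd h he
    · linarith
  ext i; fin_cases i
  · exact hv0
  · exact hv1

/-- **The flat sheet is an immersion**: at a point of the height window with `e ≠ 0` the
differential of the flat sheet (read in `ℝ⁴`) is injective. [folklore] -/
theorem injective_fderiv_coe_flatSheet {x : EuclideanSpace ℝ (Fin 2)} (hx : x 1 ∈ Ioo (10⁻¹ : ℝ) (9 / 10))
    (he : b.edgeRate ν (x 1) ≠ 0) :
    Injective (fderiv ℝ (fun x ↦ ((b.flatSheet ν x : Metric.sphere (0 : EuclideanSpace ℝ (Fin 4)) 1) : EuclideanSpace ℝ (Fin 4))) x) := by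
  have hC := b.hasFDerivAt_flatSheetCoord ν hx
  have hν : HasFDerivAt ν.coordMap (fderiv ℝ ν.coordMap
      (2 * π * b.thetaB (x 1), (1 + (1 - x 0) * b.edgeRate ν (x 1)) • framingBaseVector))
      (2 * π * b.thetaB (x 1), (1 + (1 - x 0) * b.edgeRate ν (x 1)) • framingBaseVector) :=
    ((ν.contDiff_coordMap.differentiable (by simp)) _).hasFDerivAt
  have hcomp := hν.comp x hC
  have hfun : (fun x ↦ ((b.flatSheet ν x : Metric.sphere (0 : EuclideanSpace ℝ (Fin 4)) 1) : EuclideanSpace ℝ (Fin 4))) =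
      ν.coordMap ∘ (fun x : EuclideanSpace ℝ (Fin 2) ↦
        ((2 * π * b.thetaB (x 1), (1 + (1 - x 0) * b.edgeRate ν (x 1)) • framingBaseVector) : ℝ × EuclideanSpace ℝ (Fin 2))) :=
    funext fun x ↦ b.coe_flatSheet ν x
  rw [hfun, hcomp.fderiv, ContinuousLinearMap.coe_comp]
  exact (ν.injective_fderiv_coordMap _ _).comp
    (injective_flatSheetCoordDeriv (x0 := x 0) (e' := deriv (b.edgeRate ν) (x 1)) (b.deriv_thetaB_neg hx).ne he)

end BandCore

end Literature.Topology.FourManifolds
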